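import Summits.Ventures.LatticeQCDFlow.Scoring.U1TorusTopologicalChargeTotalVariation
import HarnessLib

/-!
# The continuum limit of the `θ`-dependence: `⟨cos(θQ)⟩_{L_j,β_j} → Σ_k cos(kθ) p_v(k)`

HONEST FRAMING: exact (Metropolis-corrected) sampling algorithms for lattice gauge theory;
figures of merit are autocorrelation/cost numbers at stated couplings and volumes; no
continuum-physics claim.

Venture `LatticeQCDFlow` (cell pub-lqcd), sub-topic `Scoring`; FANOUT row 5 (`s0-sun-a`), GEN-15.
NEW WORK of the cell (placement rule).  The ratio of the `θ`-vacuum partition function to the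
`θ = 0` one is the characteristic function of the topological charge,
`Z_{L,β}(θ)/Z_{L,β}(0) = ⟨e^{iθQ}⟩ = ⟨cos(θQ)⟩ = Σ_k cos(kθ) P(Q = k)` (the law is symmetric).  From the
total-variation convergence of `Scoring/U1TorusTopologicalChargeTotalVariation.lean`:

* `integral_cos_mul_topCharge_eq_tsum` — `∫ cos(θ Q) dμ = Σ_{k∈ℤ} cos(θk) P(Q = k)`;
* **`tendsto_integral_cos_mul_topCharge`** — for `β_j → ∞`, `L_j ≥ 2`, `L_j²/β_j → v > 0` and every
  real `θ`: `∫ cos(θQ) dμ_{L_j,β_j} → Σ_{k∈ℤ} cos(θk) e^{−2π²k²/v} / Σ_m e^{−2π²m²/v}` — the continuum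
  `θ`-dependence at fixed physical volume (a ratio of theta functions), as an honest limit of
  theory-2's lattice model; more generally `tendsto_tsum_mul_wilsonMeasure_topCharge` for any bounded
  test function on the sectors.

Elementary given the parents; nothing is cited.  No sampler values.
-/

noncomputable section

open Real Filter Topology Set MeasureTheory
open scoped ENNReal
open Literature.Analysis.FunctionSpaces
open Literature.MathematicalPhysics.QuantumFieldTheory
open Literature.MathematicalPhysics.QuantumLattice (u1Rep continuous_u1Rep)
open Summit.Ventures.LatticeQCDFlow.Theory2.Lattice (topCharge)

namespace Summit.Ventures.LatticeQCDFlow.Scoring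

variable {L : ℕ} [NeZero L]

/-- **`∫ f(Q) dμ = Σ_{k∈ℤ} f(k) P(Q = k)`** as a `tsum` over all sectors (the law has finite support). -/
theorem integral_comp_topCharge_eq_tsum (β : ℝ) (f : ℝ → ℝ) :
    ∫ U, f (topCharge U) ∂(wilsonMeasure (d := 2) (L := L) u1Rep β) =
      ∑' k : ℤ, f k * (wilsonMeasure (d := 2) (L := L) u1Rep β {U | topCharge U = k}).toReal := by
  rw [integral_comp_topCharge (L := L) β f]
  refine (tsum_eq_sum (s := Finset.Icc (-((L : ℤ) ^ 2)) ((L : ℤ) ^ 2)) fun k hk => ?_).symm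
  rw [wilsonMeasure_topCharge_toReal_eq_zero_of β, mul_zero]
  simp only [Finset.mem_Icc, not_and_or, not_le] at hk
  rcases hk with hk | hk
  · rw [abs_of_neg (by nlinarith [sq_nonneg (L : ℤ)])]; linarith
  · exact lt_of_lt_of_le hk (le_abs_self k)

variable {Ls : ℕ → ℕ} [hNZ : ∀ j, NeZero (Ls j)]

/-- **Bounded test functions on the sectors**: if `|g k| ≤ G` then
`Σ_k g(k) P_{L_j,β_j}(Q = k) → Σ_k g(k) p_v(k)` (from total-variation convergence). -/
theorem tendsto_tsum_mul_wilsonMeasure_topCharge {β : ℕ → ℝ} {v : ℝ} (hv0 : 0 < v)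
    (hL : ∀ j, 2 ≤ Ls j) (hβ : Tendsto β atTop atTop)
    (hv : Tendsto (fun j => ((Ls j ^ 2 : ℕ) : ℝ) / β j) atTop (𝓝 v)) {g : ℤ → ℝ} {G : ℝ}
    (hg : ∀ k, |g k| ≤ G) :
    Tendsto (fun j => ∑' k : ℤ, g k * (wilsonMeasure (d := 2) (L := Ls j) u1Rep (β j) {U | topCharge U = k}).toReal)
      atTop (𝓝 (∑' k : ℤ, g k * (Real.exp (-(2 * π ^ 2 * (k : ℝ) ^ 2 / v)) /
        ∑' m : ℤ, Real.exp (-(2 * π ^ 2 * (m : ℝ) ^ 2 / v))))) := by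
  have hG : 0 ≤ G := (abs_nonneg _).trans (hg 0)
  have hTV := tendsto_tsum_abs_wilsonMeasure_topCharge_sub hv0 hL hβ hv
  set p : ℤ → ℝ := fun k => Real.exp (-(2 * π ^ 2 * (k : ℝ) ^ 2 / v)) /
    ∑' m : ℤ, Real.exp (-(2 * π ^ 2 * (m : ℝ) ^ 2 / v)) with hp
  set P : ℕ → ℤ → ℝ := fun j k =>
    (wilsonMeasure (d := 2) (L := Ls j) u1Rep (β j) {U | topCharge U = k}).toReal with hP
  -- summability of the pieces
  have hPsum : ∀ j, Summable (P j) := fun j => (hasSum_wilsonMeasure_topCharge_toReal (β j)).summable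
  have hθ : Summable fun m : ℤ => Real.exp (-(2 * π ^ 2 * (m : ℝ) ^ 2 / v)) := by
    have hc : 0 < 2 * π ^ 2 / v := by positivity
    refine Summable.of_nonneg_of_le (fun m => (Real.exp_pos _).le) (fun m => ?_)
      (summable_exp_neg_mul_natAbs hc)
    refine Real.exp_le_exp.2 ?_
    rw [Nat.cast_natAbs, Int.cast_abs]
    have : |(m : ℝ)| ≤ (m : ℝ) ^ 2 := by
      rw [← sq_abs]
      rcases eq_or_ne m 0 with rfl | hm
      · simp
      · have h1 : (1 : ℝ) ≤ |(m : ℝ)| := by rw [← Int.cast_abs]; exact_mod_cast Int.one_le_abs hm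
        nlinarith
    have := mul_le_mul_of_nonneg_left this hc.le
    calc -(2 * π ^ 2 * (m : ℝ) ^ 2 / v) = -(2 * π ^ 2 / v * (m : ℝ) ^ 2) := by ring
      _ ≤ -(2 * π ^ 2 / v * |(m : ℝ)|) := by linarith
  have hpsum : Summable p := hθ.div_const _
  have hdiff : ∀ j, Summable fun k => |P j k - p k| := fun j => ((hPsum j).sub hpsum).abs
  have hgP : ∀ j, Summable fun k => g k * P j k := fun j =>
    Summable.of_norm_bounded ((hPsum j).abs.mul_left G) fun k => by
      rw [Real.norm_eq_abs, abs_mul, abs_of_nonneg (ENNReal.toReal_nonneg : 0 ≤ P j k)]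
      exact mul_le_mul_of_nonneg_right (hg k) ENNReal.toReal_nonneg
  have hp0 : ∀ k, 0 ≤ p k := fun k => by
    have := hθ.tsum_pos (fun m => (Real.exp_pos _).le) 0 (Real.exp_pos _)
    positivity
  have hgp : Summable fun k => g k * p k :=
    Summable.of_norm_bounded (hpsum.abs.mul_left G) fun k => by
      rw [Real.norm_eq_abs, abs_mul, abs_of_nonneg (hp0 k)]
      exact mul_le_mul_of_nonneg_right (hg k) (hp0 k)
  -- `|Σ g (P − p)| ≤ G Σ |P − p| → 0`
  rw [Metric.tendsto_atTop] at hTV ⊢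
  intro ε hε
  obtain ⟨N, hN⟩ := hTV (ε / (G + 1)) (by positivity)
  refine ⟨N, fun j hj => ?_⟩
  have h := hN j hj
  rw [Real.dist_eq, sub_zero, abs_of_nonneg (tsum_nonneg fun k => abs_nonneg _)] at h
  rw [Real.dist_eq, ← (hgP j).tsum_sub hgp]
  have hb : |∑' k : ℤ, (g k * P j k - g k * p k)| ≤ G * ∑' k : ℤ, |P j k - p k| := by
    have hs := (hgP j).sub hgp
    have h1 := norm_tsum_le_tsum_norm hs.norm
    rw [Real.norm_eq_abs] at h1
    refine h1.trans ?_
    rw [← tsum_mul_left]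
    refine Summable.tsum_le_tsum (fun k => ?_) hs.norm ((hdiff j).mul_left G)
    rw [Real.norm_eq_abs, ← mul_sub, abs_mul]
    exact mul_le_mul_of_nonneg_right (hg k) (abs_nonneg _)
  calc |∑' k : ℤ, (g k * P j k - g k * p k)| ≤ G * ∑' k : ℤ, |P j k - p k| := hb
    _ ≤ (G + 1) * ∑' k : ℤ, |P j k - p k| :=
        mul_le_mul_of_nonneg_right (by linarith) (tsum_nonneg fun k => abs_nonneg _)
    _ < (G + 1) * (ε / (G + 1)) := mul_lt_mul_of_pos_left h (by linarith)
    _ = ε := by field_simp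

/-- **THE CONTINUUM `θ`-DEPENDENCE.**  For `β_j → ∞`, `L_j ≥ 2`, `L_j²/β_j → v > 0` and every real `θ`:
`∫ cos(θ Q) dμ_{L_j,β_j} → Σ_{k∈ℤ} cos(θk) e^{−2π²k²/v} / Σ_m e^{−2π²m²/v}`
(`= Z(θ)/Z(0)` of the continuum `U(1)` theory on a torus of area `v`). -/
theorem tendsto_integral_cos_mul_topCharge {β : ℕ → ℝ} {v : ℝ} (hv0 : 0 < v)
    (hL : ∀ j, 2 ≤ Ls j) (hβ : Tendsto β atTop atTop)
    (hv : Tendsto (fun j => ((Ls j ^ 2 : ℕ) : ℝ) / β j) atTop (𝓝 v)) (θ : ℝ) :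
    Tendsto (fun j => ∫ U, Real.cos (θ * topCharge U) ∂(wilsonMeasure (d := 2) (L := Ls j) u1Rep (β j)))
      atTop (𝓝 (∑' k : ℤ, Real.cos (θ * k) * (Real.exp (-(2 * π ^ 2 * (k : ℝ) ^ 2 / v)) /
        ∑' m : ℤ, Real.exp (-(2 * π ^ 2 * (m : ℝ) ^ 2 / v))))) := by
  have h := tendsto_tsum_mul_wilsonMeasure_topCharge hv0 hL hβ hv (g := fun k : ℤ => Real.cos (θ * k))
    (G := 1) fun k => Real.abs_cos_le_one _
  refine h.congr fun j => ?_
  rw [integral_comp_topCharge_eq_tsum (β j) (fun x => Real.cos (θ * x))]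

end Summit.Ventures.LatticeQCDFlow.Scoring
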